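import Literature.Probability.Percolation.RhombusPivotalSumBounds
import Literature.Probability.Percolation.FourArmPivotalSumWerner
import Literature.Probability.Percolation.NearCriticalScalingOneArmProofs
import Literature.Probability.Percolation.FiveArmLowerBound
import Literature.Probability.Percolation.HalfPlaneTwoArmRadiiNearCritical
import HarnessLib

/-!
# Werner's Lemma 6.2 for the rhombus: reduction to four-arm quasi-multiplicativity and the interior pivotal bound (proofs only)

Topic `Literature/Probability/Percolation`; family `crit-perc`. Sibling PROOF file of
`KestenRelationRusso.lean` (the named fact `Werner2009_lemma62`: Kesten's near-critical pivotal
count for the rhombus, `Σ_{x ∈ [0,N]²} P_t(x pivotal for 𝒞_H([0,N]²)) ≍ N² π₄(N)` uniformly for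
`N ≤ L_ε(t)`; W. Werner, *Lectures on two-dimensional critical percolation* (PCMI 16, 2009),
Lecture 6, Lemma 6.2 with Lemma 6.3; P. Nolin, EJP 13 (2008), §7.3, proof of Prop. 34, last
display, and Remark 35) and of `RhombusPivotalSumBounds.lean`, which proved
`Werner2009_lemma62_of_facts : Werner2009_lemma63 → Werner2009_fourArm_quasiMult →
Werner2009_fourArm_lowerBound → Werner2009_halfPlane_twoArm → hP → Werner2009_lemma62`, `hP` being
the interior pivotal lower bound for the RHOMBUS (every site of `[0,N]²` at distance more than
`N/4` from the boundary is pivotal with probability `≥ c π̂_t(r₀, N)` below `L(t, ε)`; Nolin 2008,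
proof of Prop. 34, last display; Werner 2009, proof of Lemma 6.2, lower bound).

This file removes two of the five inputs, now discharged in the tree
(`Werner2009_fourArm_lowerBound_holds`, `FiveArmLowerBound.lean`; `Werner2009_halfPlane_twoArm_holds`,
`HalfPlaneTwoArmRadiiNearCritical.lean`), and a third one, `Werner2009_lemma63` (four-arm
stability below `L(p)`), by running Werner's derivation of Lemma 6.3 (Lecture 6, §5: "`|(d/dp) log
π̂_p(n)| ≤ c'' d/dp h_p(n)` … integrate from `p = 1/2` to `p'`") along the RHOMBUS crossing
probability `t ↦ P_t(𝒞_H([0,N]²))` instead of Werner's `h_t(N) = P_t(𝒞_H([0,2N]×[0,N]))`: the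
integration only uses that the potential has derivative the pivotal count (Russo's formula,
`hasDerivAt_triLRCrossingProb`) and takes values in `[0, 1]`
(`real_le_exp_mul_of_rhombus_pivotal_bound`, `NearCriticalScalingOneArmProofs.lean`; this is also
how Nolin integrates, §6.2, eq. (csq_russo), with the rhombus `S_N`). Consequently the lower half
of Lemma 6.2 for the rhombus (i.e. `hP`) replaces the parallelogram fact
`Werner2009_pivotal_lowerBound` in `Werner2009_lemma63_of_facts` (`FourArmPivotalSumWerner.lean`),
and

  `Werner2009_lemma62 ⟸ Werner2009_fourArm_quasiMult ∧ hP`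
  (`Werner2009_lemma62_of_quasiMult_of_rhombus_pivotal`),

both remaining inputs being consequences of the separation and extendability of four arms below
`L(p)` (Nolin 2008, Thm. 11, Props. 12–13, 17; Werner 2009, Lecture 6, Prop. 6.1, Cor. 6.1–6.2),
which the tree does not have yet. No definition and no named fact is introduced (D-0026); `hP`
stays an explicit hypothesis, verbatim as in `Werner2009_lemma62_of_facts`.

## Contents (all proved)

* `Werner2009_lemma63_of_rhombus_lower_of_fourArm_pivotal_bound` — Lemma 6.3 from the rhombus
  lower bound `c N² π̂_t(r₀, N) ≤ Σ_{x ∈ [0,N]²} P_t(x pivotal for 𝒞_H([0,N]²))` (Werner's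
  conventions: `1/2 ≤ t`, `charLengthW`) and the four-arm pivotal estimate
  `Σ_x P_t(x pivotal for Π̂_N) ≤ C N² π̂_t π̂_t` — the rhombus twin of
  `Werner2009_lemma63_of_lower_of_fourArm_pivotal_bound`;
* `rhombusPivotalSum_lowerW_of_pointwise` — the rhombus lower bound from the pointwise interior
  bound `hP` (counting, `rhombusPivotalSum_lower_of_forall`);
* `Werner2009_lemma63_of_quasiMult_of_rhombus_pivotal` — **Lemma 6.3 from
  `Werner2009_fourArm_quasiMult` and `hP`** (the four-arm pivotal estimate is
  `fourArmPivotalSum_le_of_facts` fed with the two discharged facts);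
* `Werner2009_lemma62_of_lemma63_of_quasiMult`, `Werner2009_lemma62_of_quasiMult_of_rhombus_pivotal`
  — **Lemma 6.2 for the rhombus (`Werner2009_lemma62`) from `Werner2009_fourArm_quasiMult` and
  `hP`** (through `Werner2009_lemma62_of_facts`).

## References

* W. Werner, *Lectures on two-dimensional critical percolation*, IAS/Park City Math. Ser. 16
  (2009), Lecture 6, Lemma 6.2, Lemma 6.3 and §5 [arXiv 0710.0856, pp. 44–48] [WernerPCMI2009].
* P. Nolin, Near-critical percolation in two dimensions, *Electron. J. Probab.* 13 (2008),
  1562–1623, §6.2 (proof of Thm. 27, eq. (csq_russo)), §7.3 (proof of Prop. 34, Remark 35)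
  [arXiv 0711.4948: Thm. 26, Prop. 32, Remark 34] [Nolin2008].
* H. Kesten, Scaling relations for 2D-percolation, *Comm. Math. Phys.* 109 (1987), 109–156
  [KestenScalingCMP1987].

Mathlib: `Real.exp` API only. Tree: `real_le_exp_mul_of_rhombus_pivotal_bound`
(`NearCriticalScalingOneArmProofs.lean`), `fourArmPivotalSum_le_of_facts`
(`FourArmPivotalSumWerner.lean`), `rhombusPivotalSum_lower_of_forall`, `Werner2009_lemma62_of_facts`
(`RhombusPivotalSumBounds.lean`), `Werner2009_fourArm_lowerBound_holds` (`FiveArmLowerBound.lean`),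
`Werner2009_halfPlane_twoArm_holds` (`HalfPlaneTwoArmRadiiNearCritical.lean`), `fourArmPivotalSum`,
`fourArmProbAt`, `fourArmProbAt_half`, `fourArmProbAt_nonneg` (`WernerPivotalEstimates.lean`),
`determinedBy_armEvent` (`ArmEventsStructure.lean`), `triAnnulus` (`ArmEventsProofs.lean`),
`charLengthW_antitone` (`WernerCorrelationLengthProofs.lean`).
-/

noncomputable section

open MeasureTheory Set Finset
open scoped unitInterval

namespace Literature.Probability.Percolation

open LatticeModels

/-! ### Lemma 6.3 integrated along the rhombus crossing probability -/

/-- **Lemma 6.3 from the RHOMBUS lower pivotal bound and the four-arm pivotal estimate** (Werner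
2009, Lecture 6, §5: "`|(d/dp) log π̂_p(n)| ≤ c'' d/dp h_p(n)` … If we integrate this inequality
from `p = 1/2` to `p'` …"; Nolin 2008, §6.2, proof of Thm. 27 with eq. (csq_russo), where the
potential is the crossing probability of the rhombus `S_N`): the twin of
`Werner2009_lemma63_of_lower_of_fourArm_pivotal_bound` (`FourArmPivotalSumWerner.lean`) in which
Werner's `h_t(N) = P_t(𝒞_H([0,2N]×[0,N]))` and its pivotal count `paraPivotalSum` are replaced by
the rhombus crossing probability `P_t(𝒞_H([0,N]²))` and `rhombusPivotalSum` — the integration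
(`real_le_exp_mul_of_rhombus_pivotal_bound`) only uses Russo's formula for the potential and
`0 ≤ P_t(𝒞_H) ≤ 1`. If `c N² π̂_t(r₀, N) ≤ Σ_{x ∈ [0,N]²} P_t(x pivotal for 𝒞_H([0,N]²))` and
`Σ_x P_t(x pivotal for Π̂_N) ≤ C N² π̂_t(r₀, N) π̂_t(r₀, N)` for `1/2 ≤ t < 1/2 + δ`,
`n₁ ≤ N ≤ L(t, ε)`, then `e^{-K} π̂_{1/2}(N) ≤ π̂_t(N) ≤ e^{K} π̂_{1/2}(N)`, `K = max C 0 / c`, i.e.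
`Werner2009_lemma63`. [cite: WernerPCMI2009, Lecture 6, §5 (derivation of Lemma 6.3)] [cite: Nolin2008, §6.2, proof of Thm. 27, eq. (csq_russo) (arXiv 0711.4948: Thm. 26)] -/
theorem Werner2009_lemma63_of_rhombus_lower_of_fourArm_pivotal_bound
    (hA : ∃ ε₁ > (0 : ℝ), ∀ ⦃ε : ℝ⦄, 0 < ε → ε < ε₁ →
      ∃ r₁ : ℕ, ∀ r₀ ≥ r₁, ∃ n₁ : ℕ, ∃ δ > (0 : ℝ), ∃ c > (0 : ℝ),
        ∀ t : unitInterval, 1 / 2 ≤ (t : ℝ) → (t : ℝ) < 1 / 2 + δ →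
          ∀ N : ℕ, n₁ ≤ N → (1 / 2 < (t : ℝ) → N ≤ charLengthW ε t) →
            c * ((N : ℝ) ^ 2 * fourArmProbAt t r₀ N) ≤ rhombusPivotalSum t N)
    (h4 : ∃ ε₁ > (0 : ℝ), ∀ ⦃ε : ℝ⦄, 0 < ε → ε < ε₁ →
      ∃ r₁ : ℕ, ∀ r₀ ≥ r₁, ∃ n₁ : ℕ, ∃ δ > (0 : ℝ), ∃ C : ℝ,
        ∀ t : unitInterval, 1 / 2 ≤ (t : ℝ) → (t : ℝ) < 1 / 2 + δ →
          ∀ N : ℕ, n₁ ≤ N → (1 / 2 < (t : ℝ) → N ≤ charLengthW ε t) →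
            fourArmPivotalSum t r₀ N ≤
              C * ((N : ℝ) ^ 2 * fourArmProbAt t r₀ N) * fourArmProbAt t r₀ N) :
    Werner2009_lemma63 := by
  obtain ⟨εA, hεA, hA⟩ := hA
  obtain ⟨ε4, hε4, h4⟩ := h4
  refine ⟨min εA ε4, lt_min hεA hε4, fun ε hε hεlt => ?_⟩
  obtain ⟨rA, hrA⟩ := hA hε (hεlt.trans_le (min_le_left _ _))
  obtain ⟨r4, hr4⟩ := h4 hε (hεlt.trans_le (min_le_right _ _))
  refine ⟨max rA r4, fun r₀ hr₀ => ?_⟩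
  obtain ⟨nA, δA, hδA, cA, hcA, hbA⟩ := hrA r₀ ((le_max_left _ _).trans hr₀)
  obtain ⟨n4, δ4, hδ4, C4, hb4⟩ := hr4 r₀ ((le_max_right _ _).trans hr₀)
  set K : ℝ := max C4 0 / cA with hKdef
  have hK : 0 ≤ K := div_nonneg (le_max_right _ _) hcA.le
  refine ⟨max (max nA n4) r₀, min (min δA δ4) (1 / 4), lt_min (lt_min hδA hδ4) (by norm_num),
    Real.exp (-K), Real.exp_pos _, Real.exp K, fun t ht1 ht2 N hN hNL => ?_⟩
  have hδ₁ : min (min δA δ4) (1 / 4) ≤ δA := (min_le_left _ _).trans (min_le_left _ _)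
  have hδ₂ : min (min δA δ4) (1 / 4) ≤ δ4 := (min_le_left _ _).trans (min_le_right _ _)
  have hδ₃ : min (min δA δ4) (1 / 4) ≤ 1 / 4 := min_le_right _ _
  have hNA : nA ≤ N := ((le_max_left _ _).trans (le_max_left _ _)).trans hN
  have hN4 : n4 ≤ N := ((le_max_right _ _).trans (le_max_left _ _)).trans hN
  have hNr : r₀ ≤ N := (le_max_right _ _).trans hN
  have hπ0 : 0 ≤ critFourArmProb r₀ N := measureReal_nonneg
  have heK1 : Real.exp (-K) ≤ 1 := by rw [Real.exp_le_one_iff]; linarith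
  have h1eK : 1 ≤ Real.exp K := Real.one_le_exp hK
  rcases ht1.eq_or_lt with heq | hlt
  · -- `t = 1/2`: nothing to prove
    have ht : t = half := Subtype.ext (by rw [coe_half]; exact heq.symm)
    subst ht
    rw [fourArmProbAt_half]
    exact ⟨mul_le_of_le_one_left hπ0 heK1, le_mul_of_one_le_left hπ0 h1eK⟩
  · -- `t > 1/2`: integrate on `[1/2, t]` along `s ↦ P_s(𝒞_H([0,N]²))`
    have ht1' : (t : ℝ) < 1 := by linarith
    have ht0' : 0 < (t : ℝ) := by linarith
    have hNLt : N ≤ charLengthW ε t := hNL hlt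
    have hmin : min (t : ℝ) (1 / 2) = 1 / 2 := min_eq_right hlt.le
    have hmax : max (t : ℝ) (1 / 2) = t := max_eq_left hlt.le
    have hb := real_le_exp_mul_of_rhombus_pivotal_bound (E := armEvent ![true, false, true, false] r₀ N)
      (triAnnulus r₀ N) (determinedBy_armEvent _ hNr) ht0' ht1' N hK fun s hs1 hst => by
      rw [hmin] at hs1
      rw [hmax] at hst
      have hst' : s < t := Subtype.coe_lt_coe.1 hst
      have hsA : (s : ℝ) < 1 / 2 + δA := by linarith
      have hs4 : (s : ℝ) < 1 / 2 + δ4 := by linarith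
      have hNs : N ≤ charLengthW ε s := hNLt.trans (charLengthW_antitone hε hs1 hst'.le)
      have hA1 := hbA s hs1.le hsA N hNA fun _ => hNs
      have h41 := hb4 s hs1.le hs4 N hN4 fun _ => hNs
      have hX : (N : ℝ) ^ 2 * fourArmProbAt s r₀ N ≤ rhombusPivotalSum s N / cA := by
        rw [le_div_iff₀ hcA, mul_comm]; exact hA1
      have hP0 : 0 ≤ fourArmProbAt s r₀ N := fourArmProbAt_nonneg _ _ _
      -- pivotal sites off the annulus do not contribute
      have hsub : ∑ v ∈ triAnnulus r₀ N, (triSitePercolation s).real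
            {ω | IsPivotal (armEvent ![true, false, true, false] r₀ N) v ω} ≤
          fourArmPivotalSum s r₀ N := by
        unfold fourArmPivotalSum
        refine Finset.sum_le_sum_of_subset_of_nonneg ?_ fun v _ _ => measureReal_nonneg
        unfold triAnnulus
        exact Finset.filter_subset _ _
      calc ∑ v ∈ triAnnulus r₀ N, (triSitePercolation s).real
              {ω | IsPivotal (armEvent ![true, false, true, false] r₀ N) v ω}
          ≤ fourArmPivotalSum s r₀ N := hsub
        _ ≤ C4 * ((N : ℝ) ^ 2 * fourArmProbAt s r₀ N) * fourArmProbAt s r₀ N := h41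
        _ ≤ max C4 0 * ((N : ℝ) ^ 2 * fourArmProbAt s r₀ N) * fourArmProbAt s r₀ N :=
            mul_le_mul_of_nonneg_right
              (mul_le_mul_of_nonneg_right (le_max_left _ _) (mul_nonneg (sq_nonneg _) hP0)) hP0
        _ ≤ max C4 0 * (rhombusPivotalSum s N / cA) * fourArmProbAt s r₀ N := by gcongr
        _ = K * rhombusPivotalSum s N * (triSitePercolation s).real
              (armEvent ![true, false, true, false] r₀ N) := by
            rw [hKdef]; unfold fourArmProbAt; ring
    have hb1 : fourArmProbAt t r₀ N ≤ Real.exp K * critFourArmProb r₀ N := hb.1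
    have hb2 : critFourArmProb r₀ N ≤ Real.exp K * fourArmProbAt t r₀ N := hb.2
    refine ⟨?_, hb1⟩
    rw [Real.exp_neg, inv_mul_le_iff₀ (Real.exp_pos K)]
    exact hb2

/-! ### The rhombus lower bound from the pointwise interior bound -/

/-- **The lower half of Lemma 6.2 for the rhombus from the interior pivotal bound** (Werner 2009,
Lecture 6, proof of Lemma 6.2: "the contribution of the `O(n²)` points `x` that are at distance
more than `n/4` of the boundary … is at least `π̂_p(n)`. This shows the lower bound for
`d/dp(h_p(n))`"; Nolin 2008, proof of Prop. 34, last display): if every site `v` of `[0,N]²` with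
`N/4 < v₀, v₁ < 3N/4` is pivotal for `𝒞_H([0,N]²)` with probability `≥ c π̂_t(r₀, N)` (uniformly
for `1/2 ≤ t < 1/2 + δ`, `n₁ ≤ N ≤ L(t, ε)`), then
`(c/64) N² π̂_t(r₀, N) ≤ Σ_{x ∈ [0,N]²} P_t(x pivotal for 𝒞_H([0,N]²))` for `max n₁ 16 ≤ N`
(counting, `rhombusPivotalSum_lower_of_forall`). [cite: WernerPCMI2009, Lecture 6, proof of Lemma 6.2 (lower bound)] [cite: Nolin2008, §7.3, proof of Prop. 34, last display (arXiv 0711.4948: Prop. 32)] -/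
theorem rhombusPivotalSum_lowerW_of_pointwise
    (hP : ∃ ε₁ > (0 : ℝ), ∀ ⦃ε : ℝ⦄, 0 < ε → ε < ε₁ →
      ∃ r₁ : ℕ, ∀ r₀ ≥ r₁, ∃ n₁ : ℕ, ∃ δ > (0 : ℝ), ∃ c > (0 : ℝ),
        ∀ t : unitInterval, 1 / 2 ≤ (t : ℝ) → (t : ℝ) < 1 / 2 + δ →
          ∀ N : ℕ, n₁ ≤ N → (1 / 2 < (t : ℝ) → N ≤ charLengthW ε t) →
            ∀ v : Site 2, (N : ℤ) < 4 * v 0 → 4 * v 0 < 3 * N → (N : ℤ) < 4 * v 1 → 4 * v 1 < 3 * N →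
              c * fourArmProbAt t r₀ N ≤
                (triSitePercolation t).real {ω | IsPivotal (triLRCrossing N N) v ω}) :
    ∃ ε₁ > (0 : ℝ), ∀ ⦃ε : ℝ⦄, 0 < ε → ε < ε₁ →
      ∃ r₁ : ℕ, ∀ r₀ ≥ r₁, ∃ n₁ : ℕ, ∃ δ > (0 : ℝ), ∃ c > (0 : ℝ),
        ∀ t : unitInterval, 1 / 2 ≤ (t : ℝ) → (t : ℝ) < 1 / 2 + δ →
          ∀ N : ℕ, n₁ ≤ N → (1 / 2 < (t : ℝ) → N ≤ charLengthW ε t) →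
            c * ((N : ℝ) ^ 2 * fourArmProbAt t r₀ N) ≤ rhombusPivotalSum t N := by
  obtain ⟨ε₁, hε₁, HP⟩ := hP
  refine ⟨ε₁, hε₁, fun ε hε hεlt => ?_⟩
  obtain ⟨r₁, HP⟩ := HP hε hεlt
  refine ⟨r₁, fun r₀ hr₀ => ?_⟩
  obtain ⟨n₁, δ, hδ, c, hc, HP⟩ := HP r₀ hr₀
  refine ⟨max n₁ 16, δ, hδ, c / 64, by positivity, fun t ht1 ht2 N hN hNL => ?_⟩
  exact rhombusPivotalSum_lower_of_forall hc.le (fourArmProbAt_nonneg t r₀ N) ((le_max_right _ _).trans hN)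
    (HP t ht1 ht2 N ((le_max_left _ _).trans hN) hNL)

/-! ### Lemma 6.3 and Lemma 6.2 (rhombus) from quasi-multiplicativity and the interior pivotal bound -/

/-- **Werner's Lemma 6.3 from `Werner2009_fourArm_quasiMult` and the interior pivotal bound for
the rhombus** (Werner 2009, Lecture 6, Lemma 6.3: "Uniformly for `p' ∈ (1/2, p₀)`,
`π̂_{p'}(L(p₀)) ≍ π̂_{1/2}(L(p₀))`"; Nolin 2008, Thm. 27, `j = 4`): the four-arm pivotal estimate
`Σ_x P_t(x pivotal for Π̂_N) ≤ C N² π̂_t π̂_t` is `fourArmPivotalSum_le_of_facts` with the discharged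
facts `Werner2009_fourArm_lowerBound_holds` and `Werner2009_halfPlane_twoArm_holds`; the lower bound
of Lemma 6.2 is taken for the rhombus (`rhombusPivotalSum_lowerW_of_pointwise`) and integrated by
`Werner2009_lemma63_of_rhombus_lower_of_fourArm_pivotal_bound`. Compared with
`Werner2009_lemma63_of_facts`, the parallelogram fact `Werner2009_pivotal_lowerBound` is replaced by
its rhombus form `hP` (hypothesis, verbatim as in `Werner2009_lemma62_of_facts`; Nolin 2008, proof of
Prop. 34, last display — four-arm separation and extendability below `L(p)`). [cite: WernerPCMI2009, Lecture 6, Lemma 6.3 and §5] [cite: Nolin2008, Thm. 27 (j = 4) and §7.3, proof of Prop. 34 (arXiv 0711.4948: Thm. 26, Prop. 32)] -/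
theorem Werner2009_lemma63_of_quasiMult_of_rhombus_pivotal (hQM : Werner2009_fourArm_quasiMult)
    (hP : ∃ ε₁ > (0 : ℝ), ∀ ⦃ε : ℝ⦄, 0 < ε → ε < ε₁ →
      ∃ r₁ : ℕ, ∀ r₀ ≥ r₁, ∃ n₁ : ℕ, ∃ δ > (0 : ℝ), ∃ c > (0 : ℝ),
        ∀ t : unitInterval, 1 / 2 ≤ (t : ℝ) → (t : ℝ) < 1 / 2 + δ →
          ∀ N : ℕ, n₁ ≤ N → (1 / 2 < (t : ℝ) → N ≤ charLengthW ε t) →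
            ∀ v : Site 2, (N : ℤ) < 4 * v 0 → 4 * v 0 < 3 * N → (N : ℤ) < 4 * v 1 → 4 * v 1 < 3 * N →
              c * fourArmProbAt t r₀ N ≤
                (triSitePercolation t).real {ω | IsPivotal (triLRCrossing N N) v ω}) :
    Werner2009_lemma63 :=
  Werner2009_lemma63_of_rhombus_lower_of_fourArm_pivotal_bound (rhombusPivotalSum_lowerW_of_pointwise hP)
    (fourArmPivotalSum_le_of_facts hQM Werner2009_fourArm_lowerBound_holds
      Werner2009_halfPlane_twoArm_holds)

/-- **Lemma 6.2 for the rhombus from Lemma 6.3, quasi-multiplicativity and the interior pivotal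
bound**: `Werner2009_lemma62_of_facts` (`RhombusPivotalSumBounds.lean`) with the two discharged
facts `Werner2009_fourArm_lowerBound_holds` (`FiveArmLowerBound.lean`) and
`Werner2009_halfPlane_twoArm_holds` (`HalfPlaneTwoArmRadiiNearCritical.lean`) supplied. [cite: WernerPCMI2009, Lecture 6, Lemma 6.2 with Lemma 6.3] [cite: Nolin2008, §7.3, proof of Prop. 34 (last display) and Remark 35 (arXiv 0711.4948: Prop. 32, Remark 34)] -/
theorem Werner2009_lemma62_of_lemma63_of_quasiMult (h63 : Werner2009_lemma63)
    (hQM : Werner2009_fourArm_quasiMult)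
    (hP : ∃ ε₁ > (0 : ℝ), ∀ ⦃ε : ℝ⦄, 0 < ε → ε < ε₁ →
      ∃ r₁ : ℕ, ∀ r₀ ≥ r₁, ∃ n₁ : ℕ, ∃ δ > (0 : ℝ), ∃ c > (0 : ℝ),
        ∀ t : unitInterval, 1 / 2 ≤ (t : ℝ) → (t : ℝ) < 1 / 2 + δ →
          ∀ N : ℕ, n₁ ≤ N → (1 / 2 < (t : ℝ) → N ≤ charLengthW ε t) →
            ∀ v : Site 2, (N : ℤ) < 4 * v 0 → 4 * v 0 < 3 * N → (N : ℤ) < 4 * v 1 → 4 * v 1 < 3 * N →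
              c * fourArmProbAt t r₀ N ≤
                (triSitePercolation t).real {ω | IsPivotal (triLRCrossing N N) v ω}) :
    Werner2009_lemma62 :=
  Werner2009_lemma62_of_facts h63 hQM Werner2009_fourArm_lowerBound_holds
    Werner2009_halfPlane_twoArm_holds hP

/-- **Lemma 6.2 for the rhombus (`Werner2009_lemma62`) from `Werner2009_fourArm_quasiMult` and the
interior pivotal bound alone** (Werner 2009, Lecture 6, Lemma 6.2: "Uniformly for `n ≤ L(p)`,
`d/dp h_p(n) ≍ n² π̂_p(n)`", here for the rhombus and with the critical `π₄(N)` as in Nolin 2008,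
Remark 35: `Σ_{x ∈ S_n} P(x ⇝4 ∂S_n) ≍ n² π₄(n)`): Lemma 6.3 is
`Werner2009_lemma63_of_quasiMult_of_rhombus_pivotal`, then `Werner2009_lemma62_of_lemma63_of_quasiMult`.
The two remaining inputs — the quasi-multiplicativity of the four-arm probability below `L(p)`
(`Werner2009_fourArm_quasiMult`, Cor. 6.2) and the interior pivotal lower bound `hP` (proof of
Lemma 6.2) — are both consequences of the separation and extendability of four arms below `L(p)`
(Prop. 6.1, Cor. 6.1; Nolin 2008, Thm. 11, Props. 12–13, 17). [cite: WernerPCMI2009, Lecture 6, Lemma 6.2, Lemma 6.3, Prop. 6.1, Cor. 6.1–6.2] [cite: Nolin2008, §7.3, proof of Prop. 34 (last display) and Remark 35; Thm. 11, Props. 12–13, 17 (arXiv 0711.4948: Prop. 32, Remark 34; Thm. 10, Props. 11–12, 16)] -/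
theorem Werner2009_lemma62_of_quasiMult_of_rhombus_pivotal (hQM : Werner2009_fourArm_quasiMult)
    (hP : ∃ ε₁ > (0 : ℝ), ∀ ⦃ε : ℝ⦄, 0 < ε → ε < ε₁ →
      ∃ r₁ : ℕ, ∀ r₀ ≥ r₁, ∃ n₁ : ℕ, ∃ δ > (0 : ℝ), ∃ c > (0 : ℝ),
        ∀ t : unitInterval, 1 / 2 ≤ (t : ℝ) → (t : ℝ) < 1 / 2 + δ →
          ∀ N : ℕ, n₁ ≤ N → (1 / 2 < (t : ℝ) → N ≤ charLengthW ε t) →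
            ∀ v : Site 2, (N : ℤ) < 4 * v 0 → 4 * v 0 < 3 * N → (N : ℤ) < 4 * v 1 → 4 * v 1 < 3 * N →
              c * fourArmProbAt t r₀ N ≤
                (triSitePercolation t).real {ω | IsPivotal (triLRCrossing N N) v ω}) :
    Werner2009_lemma62 :=
  Werner2009_lemma62_of_lemma63_of_quasiMult (Werner2009_lemma63_of_quasiMult_of_rhombus_pivotal hQM hP)
    hQM hP

end Literature.Probability.Percolation
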